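import Summits.QuantumFields.YangMills.Theses.LangevinControlUV
import Summits.QuantumFields.YangMills.Theorems.HypercubicLimit.Negative.AllTimesGapFalse
import Summits.QuantumFields.YangMills.Theorems.LangevinControlUVLatticeGapInUVUnitsKnabeAmplification
import Summits.QuantumFields.YangMills.Theorems.LangevinControlUVLatticeGapInUVUnitsLightCone
import Summits.QuantumFields.YangMills.Theorems.LangevinControlUVLatticeGapInUVUnitsSamplerTranscription
import Summits.QuantumFields.YangMills.Theorems.LangevinControlUVLatticeGapInUVUnitsGapToClustering
import Summits.QuantumFields.YangMills.Theorems.LangevinControlUVLatticeGapInUVUnitsSpectralToolkit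
import Literature.Analysis.OperatorTheory.KnabeGapAmplification
import Literature.MathematicalPhysics.QuantumLattice.WilsonBlockHeatBath
import Literature.MathematicalPhysics.QuantumFieldTheory.LatticeGaugeProofs

/-!
# Line `knabe-block-sampler` — skeleton for crux `LatticeGapInUVUnits` (stmt-QuantumFields-9366)

Crux (route `LangevinControlUV`, rev 7, item 9366, rank 5 — the IMPORTED infrared leg):
`Summit.QuantumFields.YangMills.Theses.LangevinControlUV.LatticeGapInUVUnits`, literally
`∀ G (compact simple) r a, Package r a → Concl r a` (§0 `crux_iff`): every unit map `a` carrying the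
femto two-point package clusters ALL pairs of gauge-invariant local observables, volume-uniformly, at
rate `c₁ · a(β)` per lattice step on all tori `(2S+1)⁴`, `S ≥ S₁(β)`, `n ≤ S`.

Idea card `Cruxes/LatticeGapInUVUnits/Ideas/knabe-block-sampler.md` (ideator 1), MERGED by the r1
triage panel with its twin `heatbath-knabe-threshold` (ideator 3): survivor design = ideator 3's
OVERLAPPING block geometry and worst-exterior reading + ideator 1's Lean typing (complex/real Hilbert
space device, `condExp`/link-σ-algebra certificate, light-cone adapter). Panel verdicts acted on:
TRIAGE-r1-1 pass (device true, `t n = 216/(2n−1)` for range 1; "typical exterior" void; prefer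
overlaps); TRIAGE-r1-2 fail-as-typed (PARTITION certificate dies in its own Gaussian calibration,
patch gap `≍ a(β)/K`; typing hole `L = m·b` only); TRIAGE-r1-3 fail-as-typed (closed form
`γ = c·coth c / b` for partitions; use offset-2-commuting overlapping blocks; widen to all odd sides).

THE LINE. Block heat bath of Wilson's measure on the torus `(ℤ/N)⁴` with OVERLAPPING blocks: nominal
cell `b = ⌈K/a(β)⌉` lattice units, `m = N/b` uneven cells per axis (lengths in `[b, 2b]`, §1
`cellOf` — every side `N`, odd or not, is covered), blocks `B_z` = the `2⁴`-clusters of cells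
`{z, z+1}⁴` (overlap = one cell ≍ block: the generous-overlap Schwarz regime of TRIAGE-r1-2 T2 /
r1-3 T1(b), not the partition that dies by interface ping-pong), `Q_z = 1 − E[· | links outside B_z]`.
Blocks whose indices differ by `≥ 3` in some axis are at lattice distance `≥ 2`, share no plaquette
and their `Q`'s commute (non-commuting radius `R = 2`, `5⁴ − 1 = 624` neighbours). Stubs:

* S0 `stub_rulerReduction : RulerReduction` — THE TYPED-`∀a` SOCKET (see "Disproof used"): every
  unit map with the package is eventually dominated, up to a constant, by a CONTINUOUS unit map with
  the package. It is `id` on continuous rulers (`rulerReduction_of_continuous`, proved) and is the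
  unique place where the crux's known misstatement lives; under the refuter's repair C′ it drops out
  (`cruxRepaired_of_stubs`, proved from S1–S4 alone).
* S1 `stub_knabeAmplification : KnabeAmplification` — the device: Knabe–Gosset–Mozgunov–Lemm
  local-gap amplification for projections on a real Hilbert space indexed by `(ℤ/M)⁴`, commuting
  beyond sup-distance `2`, threshold `t n → 0` (count: `t n = 3000/(2n−1)`, `c = 1`). Provable now.
* S2 `stub_blockSamplerCertificate : BlockSamplerCertificate` — HARDEST, the honest residue: for
  continuous rulers with the package, ONE `β`-uniform local Poincaré inequality for the overlapping
  block sampler on `n₀`-patches of cells of size `⌈K/a(β)⌉` (gauge-invariant test functions,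
  integrated = worst-exterior form), with constant `γ` independent of `n₀` and `β`, on every torus
  `N ≥ (4n₀+8)·b`. The mass gap at one physical scale in spectral clothing.
* S3 `stub_samplerTranscription : SamplerTranscription` — the block sampler of Wilson's measure IS a
  Knabe system on `L²(μ)^𝒢`: `Q_z` are orthogonal projections preserving gauge-invariant functions,
  commute at index distance `≥ 3` (Markov property of the plaquette interaction), the variance-form
  local inequality is `γ A_P ≤ A_P²`, and `ker ∑ Q_z` = constants; so `LocalPoincare γ` gives
  `GlobalPoincare (c (γ − t n₀))`. Provable now (functional analysis + DLR on the torus).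
* S4 `stub_gapToClustering : GapToClustering` — a global block-sampler Poincaré constant `γ'` on the
  torus `(2S+1)⁴` with cell `b` gives `|corr(A, B, n)| ≤ C(A,B) e^{−ρ(γ') n/b}`: semigroup
  `e^{−tH}` (bounded generator), EXACT pull-out `μ(fg) = μ(P_t^{Λ_f} f · P_t^{Λ_g} g)` for commuting
  partial semigroups, Dyson-series light cone `‖P_t f − P_t^{Λ_f} f‖ ≤ (624 e t / D)^D ‖f‖_∞`, and
  spectral decay `‖P_t f̄‖ ≤ e^{−γ' t}‖f̄‖`; all constants combinatorial (`β`-free). Provable now.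

Composition (`stubsImplyCrux`, sorry-free): `n₀` from `t → 0` (`t n₀ < γ/2`), `b ≤ 2K/a(β)` from
`a → 0` (Disproof §4: `Tendsto a` is used exactly here), `c₁ = ρ/(2K)`, `S₁ β = (4n₀+8)⌈K/a β⌉`,
`C = max C(A,B) 0`; then S0 + `concl_of_dominated`. `LatticeGapInUVUnits_of` concludes the crux BY NAME.

Disproof used (`Cruxes/LatticeGapInUVUnits/Disproof.lean` v5, cdisprove gen 1; no `_false_without_`
theorem, no formal kill; paper verdict MISSTATED via slow step rulers, C′ = `Continuous a`):
§0 `crux_iff` (copied verbatim as this file's §0 so the composition is definitional); docblock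
PAPER KILL + PROVER NOTE — honoured structurally: S2–S4 are stated for the REPAIRED reading and
`cruxRepaired_of_stubs` proves Disproof's `CruxRepaired` verbatim from S1–S4, while S0 isolates the
typed-`∀a` residue (physically false for slow step rulers exactly as the crux is; the tenure repair
"restrict 9363/9366 to continuous unit maps" makes S0 moot); §1 `concl_of_eventually_le` + §2
`concl_smul_iff` = this file's `concl_of_dominated` (the line uses H = domination by a continuous
ruler at S0); §4 `Tendsto a` load-bearing — used in `concl_of_localPoincare` (`a β ≤ K` eventually);
§6 `packageWith_shape_tendsto_zero` — consistent and unused (`Γ` never enters; the ruler enters only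
through `⌈K/a β⌉`); §7 `not_conclUniformC_of_simple` / landed
`Negative.not_uniform_constant_clustering_of_simple` (Theorems/LatticeGapInUVUnits/Negative/
UniformConstantFalse.lean) — respected: S4 and `Concl` carry PER-PAIR constants `∀ A B, ∃ C`, never the
refuted `∃ C, ∀ A B`; landed `Negative.WeakCouplingConcentration` (§3/§6 of the Disproof) — the junk
subsingleton group cannot meet the package (re-derived in §4 below, `not_package_of_subsingleton`), so
no stub is exercised there, and `Γ(a(β)) → 0` is consistent with a line that never reads `Γ`. (The two
Negative modules are cited by name rather than imported: at publish time the farm reported them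
`remote:stale:unbuilt`; the folder keeps `line-knabe-block-sampler.with-negatives.lean`, identical but
importing both and instantiating `not_uniform_constant_clustering_of_simple` /
`not_femto_lower_bound_of_subsingleton` as `example`s, for re-check once they are built.)
-/

open scoped BigOperators InnerProductSpace
open MeasureTheory Filter Topology
open Literature.MathematicalPhysics.QuantumFieldTheory Literature.MathematicalPhysics.QuantumLattice
open Literature.MathematicalPhysics.QuantumLattice.WilsonBlockHeatBath
open Literature.Analysis.OperatorTheory.KnabeDevice
open Summit.QuantumFields.YangMills.Theses.LangevinControlUV

noncomputable section

namespace Summit.QuantumFields.YangMills.Cruxes.LatticeGapInUVUnits.KnabeBlockSampler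

/-! ## §0 Anatomy of the crux (verbatim `Cruxes/LatticeGapInUVUnits/Disproof.lean` §0) -/

section Anatomy

variable {G : Type} [Group G] [TopologicalSpace G] [IsTopologicalGroup G] [CompactSpace G]
  [MeasurableSpace G] [BorelSpace G]

/-- The femto two-point bounds in ONE periodic box `(ℤ/L)⁴` at coupling `β` (verbatim the `let`-body
of the crux's hypothesis). -/
def BoxBounds (r : LatticeRep G) (a Γ : ℝ → ℝ) (c C : ℝ) (L : ℕ) [NeZero L] (β : ℝ) : Prop :=
  let P : (Fin 4 → ZMod L) → Fin 4 → Fin 4 → GaugeConfig 4 L G → ℝ :=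
    fun x i j U => (r.N : ℝ) - (r.ρ (plaquetteHolonomy U x i j)).trace.re
  let E : (GaugeConfig 4 L G → ℝ) → ℝ := fun F => wilsonExpectation (d := 4) (L := L) r.ρ β F
  let cov : (GaugeConfig 4 L G → ℝ) → (GaugeConfig 4 L G → ℝ) → ℝ :=
    fun F F' => E (fun U => F U * F' U) - E F * E F'
  let dist : (Fin 4 → ZMod L) → (Fin 4 → ZMod L) → ℝ :=
    fun x y => Real.sqrt (∑ k : Fin 4, (((x k - y k).valMinAbs : ℤ) : ℝ) ^ 2)
  (∀ n : ℕ, 1 ≤ n → 8 * n ≤ L →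
      c * Γ ((n : ℝ) * a β) ≤ (n : ℝ) ^ 8 * cov (P 0 0 1) (P (Pi.single (2 : Fin 4) ((n : ℕ) : ZMod L)) 0 1) ∧
        (n : ℝ) ^ 8 * cov (P 0 0 1) (P (Pi.single (2 : Fin 4) ((n : ℕ) : ZMod L)) 0 1) ≤ C * Γ ((n : ℝ) * a β)) ∧
    (∀ (x y : Fin 4 → ZMod L) (i j i' j' : Fin 4), x ≠ y → i ≠ j → i' ≠ j' →
      |cov (P x i j) (P y i' j')| * dist x y ^ 8 ≤ C * Γ (dist x y * a β))

/-- The femto two-point PACKAGE of the unit map `a` (hypothesis of the crux). -/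
def Package (r : LatticeRep G) (a : ℝ → ℝ) : Prop :=
  ∃ (Γ : ℝ → ℝ) (β₀ ℓ₀ c C : ℝ), 0 < ℓ₀ ∧ 0 < c ∧ (∀ β, 0 < a β) ∧ Tendsto a atTop (𝓝 0) ∧
    (∀ s : ℝ, 0 < s → s ≤ ℓ₀ → 0 < Γ s ∧ Γ s ≤ 1) ∧
      ∀ (L : ℕ) [NeZero L] (β : ℝ), β₀ ≤ β → (L : ℝ) * a β ≤ ℓ₀ → BoxBounds r a Γ c C L β

/-- The conclusion of the crux: volume-uniform exponential clustering of all pairs of gauge-invariant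
local observables at SOME rate `c₁ · a(β)` per lattice step (per-pair constants `C`). -/
def Concl (r : LatticeRep G) (a : ℝ → ℝ) : Prop :=
  ∃ (c₁ β₂ : ℝ) (S₁ : ℝ → ℕ), 0 < c₁ ∧ ∀ A B : YMSpecies G, ∃ C : ℝ, ∀ β : ℝ, β₂ ≤ β → ∀ S n : ℕ,
    S₁ β ≤ S → n ≤ S → |latticeConnectedCorr r.ρ β (2 * S + 1) A.F B.F n| ≤ C * Real.exp (-(c₁ * a β * n))

end Anatomy

/-- **The crux uncurried** (definitional): `LatticeGapInUVUnits ↔ ∀ G r a, Package r a → Concl r a`. -/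
theorem crux_iff :
    LatticeGapInUVUnits ↔
      ∀ (G : Type) [Group G] [TopologicalSpace G] [IsTopologicalGroup G] [CompactSpace G],
        IsCompactSimpleLieGroup G →
          letI : MeasurableSpace G := borel G
          haveI : BorelSpace G := ⟨rfl⟩
          ∀ (r : LatticeRep G) (a : ℝ → ℝ), Package r a → Concl r a := by
  constructor
  · intro h G _ _ _ _ hG r a hP
    obtain ⟨Γ, β₀, ℓ₀, c, C, hℓ, hc, hpos, hlim, hΓ, hbox⟩ := hP
    exact h G hG r a ⟨Γ, β₀, ℓ₀, c, C, hℓ, hc, hpos, hlim, hΓ, fun L _ β h₁ h₂ => hbox L β h₁ h₂⟩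
  · intro h G _ _ _ _ hG r a hP
    obtain ⟨Γ, β₀, ℓ₀, c, C, hℓ, hc, hpos, hlim, hΓ, hbox⟩ := hP
    exact h G hG r a ⟨Γ, β₀, ℓ₀, c, C, hℓ, hc, hpos, hlim, hΓ, fun L _ β h₁ h₂ => hbox L β h₁ h₂⟩

/-! ## §1 Vocabulary — now in the tree

The abstract device (`cdist`, `patchOp`, `totalOp`, `KnabeWith`) is `Literature/Analysis/OperatorTheory/KnabeGapAmplification.lean`
(p77704) and the sampler geometry / σ-algebras / Poincaré inequalities (`cellOf`, `InBlock`, `InPatch`, `linkSigma`, `extSigma`,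
`patchExtSigma`, `LocalPoincare`, `GlobalPoincare`) are `Literature/MathematicalPhysics/QuantumLattice/WilsonBlockHeatBath.lean`
(p77767); both namespaces are opened above, so every name below is the tree's. -/

/-! ## §2 The stub statements (S0–S4; S5–S6 in §2b) -/

/-- **Stub S0 statement — ruler reduction (the typed-`∀a` socket).** Every unit map carrying the femto
package is eventually dominated, up to a constant `K₀`, by a CONTINUOUS unit map carrying the package.
Trivial on continuous rulers (`rulerReduction_of_continuous`); for the slow STEP rulers of the
Disproof's PAPER KILL it is (physically) false exactly as the crux is — this stub is where the typed
crux's misstatement is parked, not a work item: it becomes moot when 9366 is restated as C′. -/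
def RulerReduction : Prop :=
  ∀ (G : Type) [Group G] [TopologicalSpace G] [IsTopologicalGroup G] [CompactSpace G],
    IsCompactSimpleLieGroup G →
      letI : MeasurableSpace G := borel G
      haveI : BorelSpace G := ⟨rfl⟩
      ∀ (r : LatticeRep G) (a : ℝ → ℝ), Package r a →
        ∃ (a' : ℝ → ℝ) (K₀ : ℝ), Continuous a' ∧ Package r a' ∧ 0 < K₀ ∧ ∀ᶠ β in atTop, a β ≤ K₀ * a' β

/-- **Stub S1 statement — Knabe amplification** (the device, radius `2`): some threshold `t n → 0` and
`c > 0` work. Pure operator algebra, provable now. -/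
def KnabeAmplification : Prop :=
  ∃ (t : ℕ → ℝ) (c : ℝ), 0 < c ∧ Tendsto t atTop (𝓝 0) ∧ KnabeWith 2 t c

/-- **Stub S2 statement — the block-sampler certificate (HARDEST; the honest residue).** For every
compact simple `G`, faithful `r` and CONTINUOUS unit map `a` with the femto package there are a
physical cell size `K` and ONE constant `γ > 0` such that for every patch size `n₀`, for all large `β`
and every torus of side `N ≥ (4n₀+8)·⌈K/a β⌉`, the overlapping block sampler with nominal cell
`⌈K/a β⌉` satisfies the local Poincaré inequality with constant `γ` on gauge-invariant functions —
uniformly in `β` AND in `n₀` (massive at the block scale ⇒ generous-overlap one-level Schwarz constant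
independent of the number of subdomains; a massless/Coulomb field gives `≍ n₀⁻²` and fails, as it must
for `U(1)₄` and `SU(2)₅`). -/
def BlockSamplerCertificate : Prop :=
  ∀ (G : Type) [Group G] [TopologicalSpace G] [IsTopologicalGroup G] [CompactSpace G],
    IsCompactSimpleLieGroup G →
      letI : MeasurableSpace G := borel G
      haveI : BorelSpace G := ⟨rfl⟩
      ∀ (r : LatticeRep G) (a : ℝ → ℝ), Continuous a → Package r a →
        ∃ (K γ : ℝ), 0 < K ∧ 0 < γ ∧ ∀ n₀ : ℕ, 1 ≤ n₀ → ∃ β₂ : ℝ, ∀ β : ℝ, β₂ ≤ β →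
          ∀ (N : ℕ) [NeZero N], (4 * n₀ + 8) * ⌈K / a β⌉₊ ≤ N → LocalPoincare r.ρ β N ⌈K / a β⌉₊ n₀ γ

/-- **Stub S3 statement — transcription of the sampler into Knabe's algebra.** Whenever the abstract
device holds with `(t, c)`, `c > 0`, the local Poincaré inequality with `γ > t n₀` on every `n₀`-patch of
a torus with `m = N/b ≥ 4n₀ + 8` cells per axis gives the global one with constant `c (γ − t n₀)`:
`Q_z = 1 − E[·|extSigma z]` are orthogonal projections of `L²(μ)` preserving the gauge-invariant
subspace (gauge transformations preserve `μ` and the link σ-algebras), `Q_z Q_w = Q_w Q_z` when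
`cdist ≥ 3` in some axis (blocks at lattice distance `≥ 2`: Markov property of the plaquette
interaction), `LocalPoincare ⇒ γ A_P ≤ A_P²` (the inequality itself identifies `ker A_P`), and
`ker H` = constants (a function measurable outside every block is a.e. constant: product structure of
Haar, equivalence of `μ` with it). Provable now. -/
def SamplerTranscription : Prop :=
  ∀ (t : ℕ → ℝ) (c : ℝ), KnabeWith 2 t c → 0 < c → ∀ (G : Type) [Group G] [TopologicalSpace G] [IsTopologicalGroup G] [CompactSpace G] [MeasurableSpace G] [BorelSpace G] (r : LatticeRep G) (β : ℝ) (N b n₀ : ℕ) [NeZero N] (γ : ℝ), 1 ≤ n₀ → 1 ≤ b → (4 * n₀ + 8) * b ≤ N → 0 < γ → t n₀ < γ → LocalPoincare r.ρ β N b n₀ γ → GlobalPoincare r.ρ β N b (c * (γ - t n₀))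

/-- **Stub S4 statement — gap ⇒ clustering for the block sampler, in the crux's currency.** For every
global constant `γ > 0` there is a rate `ρ = ρ(γ) > 0` (combinatorial) such that for every pair of
gauge-invariant local observables there is `C = C(A, B)` (NOT uniform in the pair — Disproof §7) with:
on every torus `(2S+1)⁴` and nominal cell `b ≥ 1`, `GlobalPoincare γ` implies
`|corr_β(A, B, n)| ≤ C e^{−ρ n / b}` for `n ≤ S`. Proof route: `H = ∑ Q_z` is bounded, `P_t = e^{−tH}`
fixes `μ` and contracts mean-zero invariant functions by `e^{−γt}`; partial semigroups over disjoint
non-adjacent block families commute and pull out exterior-measurable factors EXACTLY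
(`μ(fg) = μ(P_t^{Λ_f}f · P_t^{Λ_g}g)`), and the Dyson series gives the light cone
`‖P_t f − P_t^{Λ_f} f‖ ≤ (624·e·t/D)^D ‖f‖_∞` at block distance `D ≍ n/(4b)`; take `t = D/(2·624·e)`.
Small tori / short separations are absorbed in `C(A,B)` (`|corr| ≤ 2 C_A C_B`). Provable now. -/
def GapToClustering : Prop :=
  ∀ (G : Type) [Group G] [TopologicalSpace G] [IsTopologicalGroup G] [CompactSpace G] [MeasurableSpace G] [BorelSpace G] (r : LatticeRep G) (γ : ℝ), 0 < γ → ∃ ρ : ℝ, 0 < ρ ∧ ∀ A B : YMSpecies G, ∃ C : ℝ, ∀ (β : ℝ) (b S n : ℕ), 1 ≤ b → n ≤ S → GlobalPoincare r.ρ β (2 * S + 1) b γ → |latticeConnectedCorr r.ρ β (2 * S + 1) A.F B.F n| ≤ C * Real.exp (-(ρ * n / b))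


/-! ## §2b (lead reshape, 2026-08-16) The abstract functional-analytic cores of S3 and S4, as separate stubs

The transcription S3 and the light-cone adapter S4 each contain a piece of textbook functional analysis on a REAL
Hilbert/Banach space for which Mathlib (pinned v4.32.0) has no ready-made tool (its continuous functional calculus
for `E →L[𝕜] E` is registered for `𝕜 = ℂ` only).  They are isolated here as hypothesis-free abstract statements,
provable from Mathlib alone, and S3/S4 are registered as implications consuming them (`stub_samplerTranscription :
SpectralToolkit → SamplerTranscription`, `stub_gapToClustering : SpectralToolkit → LightCone → GapToClustering`).

* `GapOfSquare` — for a positive operator `H` with `g • H ≤ H * H` (`g > 0`, Knabe's output) the quadratic form has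
  gap `g` on `(ker H)ᗮ`.  Sqrt-free proof: `H * H * H - g • H * H = H * (H * H - g • H)` is a product of COMMUTING
  positive operators, hence positive (Riesz–Nagy §104: `A = ∑ Aₖ²` with `A₁ = A/‖A‖`, `Aₖ₊₁ = Aₖ - Aₖ²`, each `Aₖ`,
  `1 - Aₖ` a sum of terms `P Q²`, `P ≥ 0`, so `⟪A B x, x⟫ = ∑ ⟪B Aₖ x, Aₖ x⟫ ≥ 0`); so `⟪H x, x⟫ ≥ g ‖x‖²` on
  `range H`, and by continuity on its closure `(ker H)ᗮ`.
* `SemigroupContraction` — form gap `γ` on a closed `H`-invariant subspace `W` gives `‖e^{-tH} x‖ ≤ e^{-γt} ‖x‖` on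
  `W` (`d/dt ‖e^{-tH}x‖² = -2⟪H u, u⟫ ≤ -2γ‖u‖²`, Gronwall; `hasDerivAt_exp_smul_const`).
* `LightCone` — finite speed of propagation for block-resampling semigroups `e^{-t ∑_{z∈Λ}(1 - T_z)}` generated by
  contractions `T_z` that act as the identity on vectors "located" away from `z` (axioms (A1)–(A3) below, satisfied by
  conditional expectations onto block exteriors and the subspaces of functions measurable in a region): comparing the
  full generator with its restriction to `Λ ⊇ nbhd^D(R₀)` on a vector located in `R₀` costs
  `2‖f‖ · #R₀ · (K t)^{D+1}/(D+1)!` (Dyson expansion `e^{-t#Λ} ∑ₖ tᵏ/k! (∑ T_z)ᵏ`, exact deletion of letters not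
  adjacent to the causal region, outside letters replaced by `1`; a word differs only if it contains an increasing
  adjacency chain of `D+1` kept letters ending next to `R₀`: `≤ C(k,D+1) · #R₀ · K^{D+1} · n^{k-D-1}` words).
-/

section AbstractToolkit

/-- **Spectral gap from the square inequality** (abstract, real Hilbert space): if `0 ≤ H`, `0 < g` and
`g • H ≤ H * H` in the Loewner order, then `g ‖x‖² ≤ ⟪H x, x⟫` for every `x` orthogonal to `ker H`. -/
def GapOfSquare : Prop :=
  ∀ (E : Type) [NormedAddCommGroup E] [InnerProductSpace ℝ E] [CompleteSpace E] (H : E →L[ℝ] E) (g : ℝ), 0 ≤ H → 0 < g → g • H ≤ H * H → ∀ x : E, (∀ y : E, H y = 0 → ⟪x, y⟫_ℝ = 0) → g * ‖x‖ ^ 2 ≤ ⟪H x, x⟫_ℝ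

/-- **Semigroup contraction from a form gap** (abstract, real Hilbert space): if `H` is self-adjoint, `W` is a
closed `H`-invariant subspace and `γ ‖x‖² ≤ ⟪H x, x⟫` on `W`, then `‖exp(-tH) x‖ ≤ e^{-γt} ‖x‖` for `x ∈ W`,
`t ≥ 0`. -/
def SemigroupContraction : Prop :=
  ∀ (E : Type) [NormedAddCommGroup E] [InnerProductSpace ℝ E] [CompleteSpace E] (H : E →L[ℝ] E) (W : Submodule ℝ E) (γ : ℝ), IsSelfAdjoint H → IsClosed (W : Set E) → (∀ x ∈ W, H x ∈ W) → (∀ x ∈ W, γ * ‖x‖ ^ 2 ≤ ⟪H x, x⟫_ℝ) → ∀ (t : ℝ), 0 ≤ t → ∀ x ∈ W, ‖NormedSpace.exp (-(t • H)) x‖ ≤ Real.exp (-(γ * t)) * ‖x‖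

/-- The two spectral facts consumed by S3 (`GapOfSquare`) and S4 (`SemigroupContraction`). -/
def SpectralToolkit : Prop := GapOfSquare ∧ SemigroupContraction

/-- **Abstract light cone for block-resampling semigroups** (finite speed of propagation; the block-dynamics
version of Martinelli 1999 §3 / Lieb–Robinson combinatorics, with NO commutation hypothesis).  Data: a real
Banach space `E`, a finite index set `ι` with a reflexive relation `adj` ("blocks are close") whose columns have
at most `K` elements, contractions `T z` (the block conditional expectations), and for every finite `R ⊆ ι` a
subspace `M R` ("vectors located in the region of `R`") with (A1) monotonicity, (A2) `T z (M R) ⊆ M (insert z R)`,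
(A3) `T z = id` on `M R` when `z` is adjacent to nothing in `R`.  Conclusion: for `f ∈ M R₀` and
`Λ ⊇ nbhd^{D}(R₀)`, `‖e^{-t∑_{z}(1 - T z)} f - e^{-t∑_{z∈Λ}(1 - T z)} f‖ ≤ 2‖f‖ · #R₀ · (K t)^{D+1} / (D+1)!`. -/
def LightCone : Prop :=
  ∀ (E : Type) [NormedAddCommGroup E] [NormedSpace ℝ E] [CompleteSpace E] (ι : Type) [Fintype ι] [DecidableEq ι] (adj : ι → ι → Prop) [DecidableRel adj] (K : ℕ) (T : ι → E →L[ℝ] E) (M : Finset ι → Submodule ℝ E), (∀ z, adj z z) → (∀ w, (Finset.univ.filter fun z => adj z w).card ≤ K) → (∀ z, ‖T z‖ ≤ 1) → (∀ R R' : Finset ι, R ⊆ R' → M R ≤ M R') → (∀ (z : ι) (R : Finset ι), ∀ x ∈ M R, T z x ∈ M (insert z R)) → (∀ (z : ι) (R : Finset ι), (∀ w ∈ R, ¬ adj z w) → ∀ x ∈ M R, T z x = x) → ∀ (R₀ Λ : Finset ι) (D : ℕ) (f : E), f ∈ M R₀ → (fun R : Finset ι => Finset.univ.filter fun z => ∃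 w ∈ R, adj z w)^[D] R₀ ⊆ Λ → ∀ t : ℝ, 0 ≤ t → ‖NormedSpace.exp (-(t • ∑ z : ι, (1 - T z))) f - NormedSpace.exp (-(t • ∑ z ∈ Λ, (1 - T z))) f‖ ≤ 2 * ‖f‖ * R₀.card * (K * t) ^ (D + 1) / (D + 1).factorial

end AbstractToolkit

/-! ## §3 Registered stubs (signatures written out in tree vocabulary, so that the stub proof files state them
verbatim with `import Literature.Analysis.OperatorTheory.KnabeGapAmplification` /
`import Literature.MathematicalPhysics.QuantumLattice.WilsonBlockHeatBath` and NO local definition) and the checked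
composition -/

/-- Stub S0 (typed-`∀a` socket; NOT a work item — see the docstring of `RulerReduction`). -/
theorem stub_rulerReduction : RulerReduction := by
  sorry

/-- Stub S1 = `KnabeAmplification` — LANDED p81103 (`Theorems/LangevinControlUVLatticeGapInUVUnitsKnabeAmplification.lean`, t n = 10000/n, c = 1). -/
theorem stub_knabeAmplification : ∃ (t : ℕ → ℝ) (c : ℝ), 0 < c ∧ Tendsto t atTop (𝓝 0) ∧ KnabeWith 2 t c :=
  Summit.QuantumFields.YangMills.Theorems.LatticeGapInUVUnits.KnabeBlockSampler.stub_knabeAmplification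

/-- Stub S2 (open, HARDEST: the one-scale worst-exterior block-sampler gap, β- and n₀-uniform). -/
theorem stub_blockSamplerCertificate : BlockSamplerCertificate := by
  sorry

/-- Stub S3 = `GapOfSquare → SamplerTranscription` — LANDED p86700 (`Theorems/LangevinControlUVLatticeGapInUVUnitsSamplerTranscription.lean`;
Literature infrastructure `WilsonBlockHeatBathMarkov{,2,3}.lean`, `WilsonBlockHeatBathL2.lean`). -/
theorem stub_samplerTranscription : (∀ (E : Type) [NormedAddCommGroup E] [InnerProductSpace ℝ E] [CompleteSpace E] (H : E →L[ℝ] E) (g : ℝ), 0 ≤ H → 0 < g → g • H ≤ H * H → ∀ x : E, (∀ y : E, H y = 0 → ⟪x, y⟫_ℝ = 0) → g * ‖x‖ ^ 2 ≤ ⟪H x, x⟫_ℝ) → ∀ (t : ℕ → ℝ) (c : ℝ), KnabeWith 2 t c → 0 < c → ∀ (G : Type) [Group G] [TopologicalSpace G] [IsTopologicalGroup G] [CompactSpace G] [MeasurableSpace G] [BorelSpace G] (r : LatticeRep G) (β : ℝ) (N b n₀ : ℕ) [NeZero N] (γ : ℝ), 1 ≤ n₀ → 1 ≤ b → (4 *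 n₀ + 8) * b ≤ N → 0 < γ → t n₀ < γ → LocalPoincare r.ρ β N b n₀ γ → GlobalPoincare r.ρ β N b (c * (γ - t n₀)) :=
  Summit.QuantumFields.YangMills.Theorems.LatticeGapInUVUnits.KnabeBlockSampler.stub_samplerTranscription

/-- Stub S4 = `SemigroupContraction → LightCone → GapToClustering` — LANDED p90222 (`Theorems/LangevinControlUVLatticeGapInUVUnitsGapToClustering.lean`;
Literature infrastructure `WilsonBlockHeatBathSemigroup{,2}.lean`, `WilsonBlockHeatBathLightCone{,2}.lean`; K = 625, ρ = min 1 (γ/(625e²))/2). -/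
theorem stub_gapToClustering : (∀ (E : Type) [NormedAddCommGroup E] [InnerProductSpace ℝ E] [CompleteSpace E] (H : E →L[ℝ] E) (W : Submodule ℝ E) (γ : ℝ), IsSelfAdjoint H → IsClosed (W : Set E) → (∀ x ∈ W, H x ∈ W) → (∀ x ∈ W, γ * ‖x‖ ^ 2 ≤ ⟪H x, x⟫_ℝ) → ∀ (t : ℝ), 0 ≤ t → ∀ x ∈ W, ‖NormedSpace.exp (-(t • H)) x‖ ≤ Real.exp (-(γ * t)) * ‖x‖) → (∀ (E : Type) [NormedAddCommGroup E] [NormedSpace ℝ E] [CompleteSpace E] (ι : Type) [Fintype ι] [DecidableEq ι] (adj : ι → ι → Prop) [DecidableRel adj] (K : ℕ) (T : ι → E →L[ℝ] E) (M : Finset ι → Submodule ℝ E), (∀ z, adj z z) → (∀ w, (Finset.univ.filter fun z => adj z w).card ≤ K) → (∀ z, ‖T z‖ ≤ 1) → (∀ R R' : Finset ι, R ⊆ R' → M R ≤ M R') → (∀ (z : ι) (R : Finset ι), ∀ x ∈ M R, T z x ∈ M (insert z R)) → (∀ (z : ι) (R : Finset ι), (∀ w ∈ R, ¬ adj z w)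 → ∀ x ∈ M R, T z x = x) → ∀ (R₀ Λ : Finset ι) (D : ℕ) (f : E), f ∈ M R₀ → (fun R : Finset ι => Finset.univ.filter fun z => ∃ w ∈ R, adj z w)^[D] R₀ ⊆ Λ → ∀ t : ℝ, 0 ≤ t → ‖NormedSpace.exp (-(t • ∑ z : ι, (1 - T z))) f - NormedSpace.exp (-(t • ∑ z ∈ Λ, (1 - T z))) f‖ ≤ 2 * ‖f‖ * R₀.card * (K * t) ^ (D + 1) / (D + 1).factorial) → ∀ (G : Type) [Group G] [TopologicalSpace G] [IsTopologicalGroup G] [CompactSpace G] [MeasurableSpace G] [BorelSpace G] (r : LatticeRep G) (γ : ℝ), 0 < γ → ∃ ρ : ℝ, 0 < ρ ∧ ∀ A B : YMSpecies G, ∃ C : ℝ, ∀ (β : ℝ) (b S n : ℕ), 1 ≤ b → n ≤ S → GlobalPoincare r.ρ β (2 * S + 1) b γ → |latticeConnectedCorr r.ρ β (2 * S + 1) A.F B.F n| ≤ C * Real.exp (-(ρ * n / b)) :=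
  Summit.QuantumFields.YangMills.Theorems.LatticeGapInUVUnits.KnabeBlockSampler.stub_gapToClustering

/-- Stub S5 = `GapOfSquare ∧ SemigroupContraction` — LANDED p90500 (`Theorems/LangevinControlUVLatticeGapInUVUnitsSpectralToolkit.lean`; elementary: positivity of `H` on `g•y − Hy`; Gronwall). -/
theorem stub_spectralToolkit : (∀ (E : Type) [NormedAddCommGroup E] [InnerProductSpace ℝ E] [CompleteSpace E] (H : E →L[ℝ] E) (g : ℝ), 0 ≤ H → 0 < g → g • H ≤ H * H → ∀ x : E, (∀ y : E, H y = 0 → ⟪x, y⟫_ℝ = 0) → g * ‖x‖ ^ 2 ≤ ⟪H x, x⟫_ℝ) ∧ (∀ (E : Type) [NormedAddCommGroup E] [InnerProductSpace ℝ E] [CompleteSpace E] (H : E →L[ℝ] E) (W : Submodule ℝ E) (γ : ℝ), IsSelfAdjoint H → IsClosed (W : Set E) → (∀ x ∈ W, H x ∈ W) → (∀ x ∈ W, γ * ‖x‖ ^ 2 ≤ ⟪H x, x⟫_ℝ) → ∀ (t : ℝ), 0 ≤ t → ∀ x ∈ W, ‖NormedSpace.exp (-(t • H)) x‖ ≤ Real.exp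 (-(γ * t)) * ‖x‖) :=
  Summit.QuantumFields.YangMills.Theorems.LatticeGapInUVUnits.KnabeBlockSampler.stub_spectralToolkit

/-- Stub S6 = `LightCone` — LANDED p80165 (`Theorems/LangevinControlUVLatticeGapInUVUnitsLightCone.lean`; induction on the Taylor order with (site, depth-budget) states). -/
theorem stub_lightCone : ∀ (E : Type) [NormedAddCommGroup E] [NormedSpace ℝ E] [CompleteSpace E] (ι : Type) [Fintype ι] [DecidableEq ι] (adj : ι → ι → Prop) [DecidableRel adj] (K : ℕ) (T : ι → E →L[ℝ] E) (M : Finset ι → Submodule ℝ E), (∀ z, adj z z) → (∀ w, (Finset.univ.filter fun z => adj z w).card ≤ K) → (∀ z, ‖T z‖ ≤ 1) → (∀ R R' : Finset ι, R ⊆ R' → M R ≤ M R') → (∀ (z : ι) (R : Finset ι), ∀ x ∈ M R, T z x ∈ M (insert z R)) → (∀ (z : ι) (R : Finset ι), (∀ w ∈ R, ¬ adj z w) → ∀ x ∈ M R, T z x = x) → ∀ (R₀ Λ : Finset ι) (D : ℕ) (f : E), f ∈ M R₀ → (fun R : Finset ι => Finset.univ.filter fun z => ∃ w ∈ R, adj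 z w)^[D] R₀ ⊆ Λ → ∀ t : ℝ, 0 ≤ t → ‖NormedSpace.exp (-(t • ∑ z : ι, (1 - T z))) f - NormedSpace.exp (-(t • ∑ z ∈ Λ, (1 - T z))) f‖ ≤ 2 * ‖f‖ * R₀.card * (K * t) ^ (D + 1) / (D + 1).factorial :=
  Summit.QuantumFields.YangMills.Theorems.LatticeGapInUVUnits.KnabeBlockSampler.stub_lightCone

section Composition

variable {G : Type} [Group G] [TopologicalSpace G] [IsTopologicalGroup G] [CompactSpace G]
  [MeasurableSpace G] [BorelSpace G]

/-- S0 is the identity on continuous rulers (so under the repair C′ it carries no content). -/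
theorem rulerReduction_of_continuous (r : LatticeRep G) {a : ℝ → ℝ} (ha : Continuous a)
    (hP : Package r a) :
    ∃ (a' : ℝ → ℝ) (K₀ : ℝ), Continuous a' ∧ Package r a' ∧ 0 < K₀ ∧ ∀ᶠ β in atTop, a β ≤ K₀ * a' β :=
  ⟨a, 1, ha, hP, one_pos, Eventually.of_forall fun β => by simp⟩

/-- **Domination transfer** (Disproof §1 `concl_of_eventually_le` and §2 `concl_smul_iff` in one step):
clustering in the units of `a'` and `a ≤ K₀ a'` eventually give clustering in the units of `a`, with rate
constant `c₁/K₀`. -/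
theorem concl_of_dominated (r : LatticeRep G) {a a' : ℝ → ℝ} (h : Concl r a') {K₀ : ℝ} (hK : 0 < K₀)
    (hdom : ∀ᶠ β in atTop, a β ≤ K₀ * a' β) : Concl r a := by
  obtain ⟨c₁, β₂, S₁, hc, h⟩ := h
  obtain ⟨βs, hβs⟩ := eventually_atTop.1 hdom
  refine ⟨c₁ / K₀, max β₂ βs, S₁, div_pos hc hK, fun A B => ?_⟩
  obtain ⟨C, hC⟩ := h A B
  refine ⟨max C 0, fun β hβ S n hS hn => ?_⟩
  have hβ₂ : β₂ ≤ β := (le_max_left _ _).trans hβ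
  have hle : a β ≤ K₀ * a' β := hβs β ((le_max_right _ _).trans hβ)
  refine (hC β hβ₂ S n hS hn).trans ?_
  have hn0 : (0 : ℝ) ≤ n := Nat.cast_nonneg n
  have key : c₁ / K₀ * a β * n ≤ c₁ * a' β * n := by
    refine mul_le_mul_of_nonneg_right ?_ hn0
    calc c₁ / K₀ * a β ≤ c₁ / K₀ * (K₀ * a' β) := mul_le_mul_of_nonneg_left hle (div_pos hc hK).le
      _ = c₁ / K₀ * K₀ * a' β := by ring
      _ = c₁ * a' β := by rw [div_mul_cancel₀ c₁ hK.ne']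
  calc C * Real.exp (-(c₁ * a' β * n)) ≤ max C 0 * Real.exp (-(c₁ * a' β * n)) :=
        mul_le_mul_of_nonneg_right (le_max_left _ _) (Real.exp_pos _).le
    _ ≤ max C 0 * Real.exp (-(c₁ / K₀ * a β * n)) :=
        mul_le_mul_of_nonneg_left (Real.exp_le_exp.2 (neg_le_neg key)) (le_max_right _ _)

/-- **The pipeline S1 + (local certificate) + S3 + S4 ⇒ `Concl`.** From the device's `(t, c)` choose the
patch size `n₀` with `t n₀ < γ/2`; from `a → 0` choose `β₃` with `a β ≤ K` beyond it, so that the nominal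
cell `b = ⌈K/a β⌉` satisfies `b · a(β) ≤ 2K`; the local inequality on the torus `(2S+1)⁴`,
`S ≥ S₁ β := (4n₀+8)⌈K/a β⌉`, is transcribed (S3) into the global one with constant `c(γ − t n₀) > 0`,
and S4 turns it into clustering at rate `ρ n/b ≥ (ρ/2K) a(β) n`. -/
theorem concl_of_localPoincare (hK : KnabeAmplification) (hT : SamplerTranscription)
    (hC : GapToClustering) (r : LatticeRep G) {a : ℝ → ℝ} (hpos : ∀ β, 0 < a β)
    (hlim : Tendsto a atTop (𝓝 0)) {K γ : ℝ} (hKpos : 0 < K) (hγ : 0 < γ)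
    (hloc : ∀ n₀ : ℕ, 1 ≤ n₀ → ∃ β₂ : ℝ, ∀ β : ℝ, β₂ ≤ β → ∀ (N : ℕ) [NeZero N],
      (4 * n₀ + 8) * ⌈K / a β⌉₊ ≤ N → LocalPoincare r.ρ β N ⌈K / a β⌉₊ n₀ γ) :
    Concl r a := by
  obtain ⟨t, c, hc, ht, hKW⟩ := hK
  -- patch size from the threshold `t → 0`
  have hev : ∀ᶠ n in atTop, t n < γ / 2 := ht (Iio_mem_nhds (half_pos hγ))
  obtain ⟨n₀, hn₀, htn₀⟩ := ((eventually_ge_atTop 1).and hev).exists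
  have htn₀' : t n₀ < γ := by linarith
  obtain ⟨β₂, hβ₂⟩ := hloc n₀ hn₀
  have hgl : 0 < c * (γ - t n₀) := mul_pos hc (by linarith)
  obtain ⟨ρ, hρ, hAB⟩ := hC G r (c * (γ - t n₀)) hgl
  -- `a β ≤ K` eventually (this is where `Tendsto a atTop (𝓝 0)` is load-bearing, Disproof §4)
  have hevK : ∀ᶠ β in atTop, a β < K := hlim (Iio_mem_nhds hKpos)
  obtain ⟨β₃, hβ₃⟩ := eventually_atTop.1 hevK
  refine ⟨ρ / (2 * K), max β₂ β₃, fun β => (4 * n₀ + 8) * ⌈K / a β⌉₊, by positivity, fun A B => ?_⟩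
  obtain ⟨C, hCAB⟩ := hAB A B
  refine ⟨max C 0, fun β hβ S n hS hn => ?_⟩
  have hβ2 : β₂ ≤ β := (le_max_left _ _).trans hβ
  have haK : a β < K := hβ₃ β ((le_max_right _ _).trans hβ)
  have hKa : 0 < K / a β := div_pos hKpos (hpos β)
  have hb1 : 1 ≤ ⌈K / a β⌉₊ := Nat.one_le_iff_ne_zero.2 (Nat.ceil_pos.2 hKa).ne'
  have hN : (4 * n₀ + 8) * ⌈K / a β⌉₊ ≤ 2 * S + 1 := hS.trans (by omega)
  have hLP : LocalPoincare r.ρ β (2 * S + 1) ⌈K / a β⌉₊ n₀ γ := hβ₂ β hβ2 (2 * S + 1) hN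
  have hGP : GlobalPoincare r.ρ β (2 * S + 1) ⌈K / a β⌉₊ (c * (γ - t n₀)) :=
    hT t c hKW hc G r β (2 * S + 1) ⌈K / a β⌉₊ n₀ γ hn₀ hb1 hN hγ htn₀' hLP
  have hcorr := hCAB β ⌈K / a β⌉₊ S n hb1 hn hGP
  refine hcorr.trans ?_
  -- compare the exponents: `ρ/(2K) · a β · n ≤ ρ · n / ⌈K/a β⌉` because `⌈K/a β⌉ · a β ≤ 2K`
  have hbR : ((⌈K / a β⌉₊ : ℕ) : ℝ) < K / a β + 1 := Nat.ceil_lt_add_one hKa.le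
  have hba : ((⌈K / a β⌉₊ : ℕ) : ℝ) * a β ≤ 2 * K := by
    have h1 : ((⌈K / a β⌉₊ : ℕ) : ℝ) * a β < (K / a β + 1) * a β := mul_lt_mul_of_pos_right hbR (hpos β)
    have h2 : (K / a β + 1) * a β = K + a β := by
      rw [add_mul, one_mul, div_mul_cancel₀ K (hpos β).ne']
    linarith
  have hbpos : (0 : ℝ) < ((⌈K / a β⌉₊ : ℕ) : ℝ) := by exact_mod_cast hb1
  have key : ρ / (2 * K) * a β * n ≤ ρ * n / (⌈K / a β⌉₊ : ℕ) := by
    rw [le_div_iff₀ hbpos]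
    have e : ρ / (2 * K) * a β * n * ((⌈K / a β⌉₊ : ℕ) : ℝ) =
        ρ * n * ((((⌈K / a β⌉₊ : ℕ) : ℝ)) * a β) / (2 * K) := by ring
    rw [e, div_le_iff₀ (by positivity : (0 : ℝ) < 2 * K)]
    exact mul_le_mul_of_nonneg_left hba (by positivity)
  calc C * Real.exp (-(ρ * n / (⌈K / a β⌉₊ : ℕ))) ≤ max C 0 * Real.exp (-(ρ * n / (⌈K / a β⌉₊ : ℕ))) :=
        mul_le_mul_of_nonneg_right (le_max_left _ _) (Real.exp_pos _).le
    _ ≤ max C 0 * Real.exp (-(ρ / (2 * K) * a β * n)) :=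
        mul_le_mul_of_nonneg_left (Real.exp_le_exp.2 (neg_le_neg key)) (le_max_right _ _)

end Composition

/-- **Final assembly from an S0-shaped witness.** Given, for the ruler `a`, a continuous dominating
ruler `a'` with the package (the shape S0 delivers, and the identity delivers for continuous `a`): S2 at
`a'` gives the local certificate, `concl_of_localPoincare` (S1, S3, S4) clusters in the units of `a'`,
and `concl_of_dominated` returns to the units of `a`. -/
theorem concl_of_reduction (h1 : KnabeAmplification) (h2 : BlockSamplerCertificate)
    (h3 : SamplerTranscription) (h4 : GapToClustering)
    {G : Type} [Group G] [TopologicalSpace G] [IsTopologicalGroup G] [CompactSpace G]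
    (hG : IsCompactSimpleLieGroup G) :
    letI : MeasurableSpace G := borel G
    haveI : BorelSpace G := ⟨rfl⟩
    ∀ (r : LatticeRep G) (a : ℝ → ℝ),
      (∃ (a' : ℝ → ℝ) (K₀ : ℝ), Continuous a' ∧ Package r a' ∧ 0 < K₀ ∧ ∀ᶠ β in atTop, a β ≤ K₀ * a' β) →
        Concl r a := by
  letI : MeasurableSpace G := borel G
  haveI : BorelSpace G := ⟨rfl⟩
  intro r a hred
  obtain ⟨a', K₀, ha', hP', hK₀, hdom⟩ := hred
  obtain ⟨K, γ, hK, hγ, hloc⟩ := h2 G hG r a' ha' hP'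
  obtain ⟨Γ, β₀, ℓ₀, c, C, -, -, hpos, hlim, -, -⟩ := hP'
  exact concl_of_dominated r (concl_of_localPoincare h1 h3 h4 r hpos hlim hK hγ hloc) hK₀ hdom

/-- **The repaired crux C′** (verbatim `Disproof.CruxRepaired`): the crux restricted to CONTINUOUS unit
maps. -/
def CruxRepaired : Prop :=
  ∀ (G : Type) [Group G] [TopologicalSpace G] [IsTopologicalGroup G] [CompactSpace G],
    IsCompactSimpleLieGroup G →
      letI : MeasurableSpace G := borel G
      haveI : BorelSpace G := ⟨rfl⟩
      ∀ (r : LatticeRep G) (a : ℝ → ℝ), Continuous a → Package r a → Concl r a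

/-- **S1–S4 prove the repaired crux outright** (S0 replaced by the identity
`rulerReduction_of_continuous`): the line is a line for C′, as every card and the triage panel say; the
typed crux needs S0 on top. -/
theorem cruxRepaired_of_stubs (h1 : KnabeAmplification) (h2 : BlockSamplerCertificate)
    (h3 : SamplerTranscription) (h4 : GapToClustering) : CruxRepaired := by
  intro G _ _ _ _ hG
  letI : MeasurableSpace G := borel G
  haveI : BorelSpace G := ⟨rfl⟩
  intro r a ha hP
  exact concl_of_reduction h1 h2 h3 h4 hG r a (rulerReduction_of_continuous r ha hP)

/-- **The reduction statement**: the five stub statements imply the crux (by name). Wrapped in a `def`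
so that the only theorem of this file whose stated conclusion is the crux decl is the hypothesis-free
`LatticeGapInUVUnits_of` below. -/
def StubsImplyCrux : Prop :=
  RulerReduction → KnabeAmplification → BlockSamplerCertificate → (SpectralToolkit → SamplerTranscription) →
    (SpectralToolkit → LightCone → GapToClustering) → SpectralToolkit → LightCone → LatticeGapInUVUnits

/-- **The composition (kernel-checked, no `sorry`).** S5/S6 discharge the hypotheses of S3/S4; S0 hands a
continuous dominating ruler `a'` with the package; `concl_of_reduction` does the rest. -/
theorem stubsImplyCrux : StubsImplyCrux := by
  intro h0 h1 h2 h3 h4 h5 h6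
  rw [crux_iff]
  intro G _ _ _ _ hG
  letI : MeasurableSpace G := borel G
  haveI : BorelSpace G := ⟨rfl⟩
  intro r a hP
  exact concl_of_reduction h1 h2 (h3 h5) (h4 h5 h6) hG r a (h0 G hG r a hP)

/-- **The skeleton: the crux BY NAME from the five registered stubs** (its only `sorry`s are the stubs';
the composition `stubsImplyCrux` is sorry-free). -/
theorem LatticeGapInUVUnits_of : LatticeGapInUVUnits :=
  stubsImplyCrux stub_rulerReduction stub_knabeAmplification stub_blockSamplerCertificate
    (fun h => stub_samplerTranscription h.1) (fun h => stub_gapToClustering h.2) stub_spectralToolkit stub_lightCone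

/- The LANDED reduction theorems (`Theorems/LangevinControlUVLatticeGapInUVUnitsReduction.lean`, p92432, commit 4951c2ec7c24):
`…Theorems.LatticeGapInUVUnits.KnabeBlockSampler.latticeGapInUVUnits_of_rulerReduction_of_blockSamplerCertificate :
RulerReduction → BlockSamplerCertificate → LatticeGapInUVUnits` and `…cruxRepaired_of_blockSamplerCertificate :
BlockSamplerCertificate → CruxRepaired` (explicit statements, definitionally the skeleton's): the crux is two stubs away (S0, S2), the
repaired crux C′ ONE stub away (S2).  (Not imported in this published copy until the hub has built that module.) -/

/-! ## §4 Checks against the negative side (Disproof §1/§3/§7; landed `Theorems/LatticeGapInUVUnits/Negative/*`) -/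

section NegativeChecks

variable {G : Type} [Group G] [TopologicalSpace G] [IsTopologicalGroup G] [CompactSpace G]
  [MeasurableSpace G] [BorelSpace G]

/-- With rate constant `0` the conclusion shape holds outright for EVERY ruler (Disproof §1
`conclRate_zero`, via the tree's a-priori bound `abs_latticeConnectedCorr_le`): all content of `Concl`
sits in `0 < c₁`, which the pipeline produces as `ρ/(2K)` from S4's `ρ > 0` and S2's `K > 0`; and the
constant is PER PAIR (`∀ A B, ∃ C`), the uniform-`C` shape being refuted for compact simple `G` by the
landed `Negative.not_uniform_constant_clustering_of_simple`. -/
example (r : LatticeRep G) (a : ℝ → ℝ) (A B : YMSpecies G) :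
    ∃ C : ℝ, ∀ (β : ℝ) (S n : ℕ),
      |latticeConnectedCorr r.ρ β (2 * S + 1) A.F B.F n| ≤ C * Real.exp (-(0 * a β * n)) := by
  obtain ⟨CA, hCA⟩ := A.bounded
  obtain ⟨CB, hCB⟩ := B.bounded
  refine ⟨2 * (CA * CB), fun β S n => ?_⟩
  simpa using Summit.QuantumFields.YangMills.Theorems.HypercubicLimit.Negative.abs_latticeConnectedCorr_le
    r β (2 * S + 1) hCA hCB n

/-- For a trivial (subsingleton) gauge group every Wilson expectation is evaluation at the trivial
configuration (Disproof §3; landed as `Negative.wilsonExpectation_eq_apply_one_of_subsingleton`). -/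
theorem wilsonExpectation_eq_apply_one_of_subsingleton [Subsingleton G] (r : LatticeRep G) (β : ℝ)
    (L : ℕ) [NeZero L] (F : GaugeConfig 4 L G → ℝ) :
    wilsonExpectation (d := 4) (L := L) r.ρ β F = F 1 := by
  haveI := isProbabilityMeasure_wilsonMeasure (d := 4) (L := L) r.ρ r.continuous β
  have hF : F = fun _ => F 1 := funext fun U => congrArg F (Subsingleton.elim _ _)
  rw [hF]
  simp [wilsonExpectation]

/-- **No junk regime for the pipeline**: for a subsingleton gauge group the PACKAGE (hypothesis of S0, S2
and of the crux) is unsatisfiable — the femto lower bound `0 < c Γ(a β) ≤ Cov = 0` fails in the box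
`L = 8` (Disproof §3 `not_package_of_subsingleton`; landed `Negative.not_femto_lower_bound_of_subsingleton`).
So no stub is ever instantiated where the gauge group is trivial. -/
theorem not_package_of_subsingleton [Subsingleton G] (r : LatticeRep G) (a : ℝ → ℝ) : ¬ Package r a := by
  rintro ⟨Γ, β₀, ℓ₀, c, C, hℓ, hc, hpos, hlim, hΓ, hbox⟩
  have hev : ∀ᶠ β in atTop, a β < ℓ₀ / 8 := hlim (Iio_mem_nhds (by positivity))
  obtain ⟨β, hβ₀, hβ⟩ := ((eventually_ge_atTop β₀).and hev).exists
  haveI : NeZero (8 : ℕ) := ⟨by norm_num⟩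
  have hB : BoxBounds r a Γ c C 8 β := hbox 8 β hβ₀ (by push_cast; linarith)
  obtain ⟨hax, -⟩ := hB
  have h1 := (hax 1 le_rfl (by norm_num)).1
  simp only [Nat.cast_one, one_mul, one_pow, wilsonExpectation_eq_apply_one_of_subsingleton, sub_self,
    mul_zero] at h1
  have hΓ1 := (hΓ (a β) (hpos β) (by linarith)).1
  nlinarith

end NegativeChecks

end Summit.QuantumFields.YangMills.Cruxes.LatticeGapInUVUnits.KnabeBlockSampler

end
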